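import HarnessLib
import Literature.NumberTheory.LFunctions.DedekindZeta
import Mathlib.NumberTheory.LSeries.Nonvanishing
import Mathlib.Analysis.Complex.Convex

/-!
# `DedekindQuotientEntire` (stmt-Langlands-17271) — Negative knowledge: the convergence guard
# `1 < s.re` in the conclusion is load-bearing (Mathlib's `dedekindZeta` is the Dirichlet SERIES)

Crux-disprover lemma (cdisprove, 2026-08-17) for the crux `DedekindQuotientEntire` of route
`DedekindQuotient1951`, whose conclusion is
`∃ g, DifferentiableOn ℂ g {s | 0 < s.re} ∧ ∀ s, 1 < s.re → g s * riemannZeta s = dedekindZeta K s`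
("`ζ_K/ζ` is holomorphic on `Re s > 0`", Dedekind's conjecture for `K` — so no `¬`-theorem of the
crux itself is expected: any refutation would exhibit a counterexample to Dedekind's conjecture).
This file refutes the NATURAL STRENGTHENING in which the identity `g·ζ = ζ_K` is demanded on the whole
half-plane `Re s > 0` instead of `Re s > 1`, for EVERY number field `K`:

* `not_LSeriesSummable_dedekindZeta_of_re_le_one` — the Dirichlet series of `ζ_K` diverges at every
  `s` with `Re s ≤ 1` (if it converged it would converge absolutely at `1`, bounding `ζ_K(σ)` for real
  `σ > 1`, against the class-number-formula pole `(σ-1)ζ_K(σ) → Res ζ_K > 0`, Mathlib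
  `NumberField.tendsto_sub_one_mul_dedekindZeta_nhdsGT`);
* `dedekindZeta_eq_zero_of_re_le_one` — hence Mathlib's `NumberField.dedekindZeta K s`, an
  `LSeries`, takes the junk value `0` on `Re s ≤ 1`;
* `dedekindQuotientEntire_conclusion_false_on_halfplane` — there is NO `g` holomorphic on
  `Re s > 0` with `g s * riemannZeta s = dedekindZeta K s` for all `Re s > 0`: on the line
  `Re s = 1` the right side is `0` and `ζ ≠ 0` (`riemannZeta_ne_zero_of_one_le_re`), so `g` vanishes
  there, hence identically on the connected half-plane (identity principle), contradicting the pole of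
  `ζ_K` at `1`.

Consequence for provers/planners: the guard `1 < s.re` in the crux (and in the lead's stub
`stub_completeThenMultiply`) cannot be relaxed; a conclusion phrased on `Re s > 0` must use the
continuation `Literature.NumberTheory.LFunctions.dedekindZetaCont`, never the series.
No statement of the route is used or asserted. [folklore]
-/

set_option linter.dupNamespace false -- project-wide option (lakefile weak.linter.dupNamespace); `Summit.Langlands.Langlands` is the mandated namespace

noncomputable section

open scoped Topology NumberField
open Filter Set Complex

namespace Summit.Langlands.Langlands.Theorems.DedekindQuotientEntire.Negative

/-- **The Dedekind zeta series diverges on `Re s ≤ 1`.** For the coefficient sequence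
`a_n = #{I ⊆ 𝓞 K | N(I) = n}` of Mathlib's `NumberField.dedekindZeta K = LSeries a`: if the series
converged at some `s` with `Re s ≤ 1` it would converge absolutely at `1`, so `‖ζ_K(σ)‖ ≤ Σ a_n/n`
for all real `σ ≥ 1`; but `(σ-1)ζ_K(σ) → Res_{s=1} ζ_K ≠ 0` as `σ → 1⁺`
(`NumberField.tendsto_sub_one_mul_dedekindZeta_nhdsGT`, `dedekindZeta_residue_ne_zero`). [folklore] -/
theorem not_LSeriesSummable_dedekindZeta_of_re_le_one (K : Type) [Field K] [NumberField K]
    {s : ℂ} (hs : s.re ≤ 1) :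
    ¬ LSeriesSummable (fun n ↦ (Nat.card {I : Ideal (𝓞 K) // Ideal.absNorm I = n} : ℂ)) s := by
  intro hsum
  set a : ℕ → ℂ := fun n ↦ (Nat.card {I : Ideal (𝓞 K) // Ideal.absNorm I = n} : ℂ) with ha
  have hsum1 : LSeriesSummable a 1 := hsum.of_re_le_re (by simpa using hs)
  set M : ℝ := ∑' n, ‖LSeries.term a 1 n‖ with hM
  have hbound : ∀ σ : ℝ, 1 ≤ σ → ‖NumberField.dedekindZeta K σ‖ ≤ M := by
    intro σ hσ
    have hσ' : (1 : ℂ).re ≤ (σ : ℂ).re := by simpa using hσ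
    have hσs : LSeriesSummable a σ := hsum1.of_re_le_re hσ'
    calc ‖NumberField.dedekindZeta K σ‖ = ‖∑' n, LSeries.term a σ n‖ := rfl
      _ ≤ ∑' n, ‖LSeries.term a σ n‖ := norm_tsum_le_tsum_norm hσs.norm
      _ ≤ M := Summable.tsum_le_tsum
          (fun n => LSeries.norm_term_le_of_re_le_re a hσ' n) hσs.norm hsum1.norm
  have hlim := NumberField.tendsto_sub_one_mul_dedekindZeta_nhdsGT K
  have hzero : Tendsto (fun σ : ℝ ↦ ((σ : ℂ) - 1) * NumberField.dedekindZeta K σ)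
      (𝓝[>] 1) (𝓝 0) := by
    refine squeeze_zero_norm' (a := fun σ : ℝ => (σ - 1) * M) ?_ ?_
    · filter_upwards [self_mem_nhdsWithin] with σ hσ
      rw [norm_mul]
      have h1 : ‖((σ : ℂ) - 1)‖ = σ - 1 := by
        rw [show ((σ : ℂ) - 1) = ((σ - 1 : ℝ) : ℂ) by push_cast; ring, Complex.norm_real,
          Real.norm_of_nonneg (by linarith [mem_Ioi.1 hσ])]
      rw [h1]
      exact mul_le_mul_of_nonneg_left (hbound σ (le_of_lt hσ)) (by linarith [mem_Ioi.1 hσ])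
    · have hc : Tendsto (fun σ : ℝ => (σ - 1) * M) (𝓝 1) (𝓝 ((1 - 1) * M)) :=
        ((continuous_sub_right (1 : ℝ)).mul continuous_const).tendsto 1
      simpa using hc.mono_left nhdsWithin_le_nhds
  have heq := tendsto_nhds_unique hlim hzero
  exact NumberField.dedekindZeta_residue_ne_zero K (by exact_mod_cast heq)

/-- Hence Mathlib's `NumberField.dedekindZeta K s` (an `LSeries`, i.e. a `tsum`) is the junk value
`0` whenever `Re s ≤ 1`. [folklore] -/
theorem dedekindZeta_eq_zero_of_re_le_one (K : Type) [Field K] [NumberField K] {s : ℂ}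
    (hs : s.re ≤ 1) : NumberField.dedekindZeta K s = 0 :=
  tsum_eq_zero_of_not_summable (not_LSeriesSummable_dedekindZeta_of_re_le_one K hs)

/-- **Refuted natural strengthening of the conclusion of `DedekindQuotientEntire`.** For EVERY
number field `K` there is NO `g` holomorphic on `Re s > 0` with `g·ζ = dedekindZeta K` on the WHOLE
half-plane `Re s > 0` (the crux rightly asks for the identity on `Re s > 1` only): on the line
`Re s = 1` the right side is `0` (`dedekindZeta_eq_zero_of_re_le_one`) while `ζ(1+it) ≠ 0`
(`riemannZeta_ne_zero_of_one_le_re`), so `g` vanishes on that line, hence on the connected open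
half-plane (`AnalyticOnNhd.eqOn_zero_of_preconnected_of_frequently_eq_zero`), and then
`ζ_K(σ) = g(σ)ζ(σ) = 0` for real `σ > 1`, contradicting the pole at `1`. [folklore] -/
theorem dedekindQuotientEntire_conclusion_false_on_halfplane (K : Type) [Field K] [NumberField K] :
    ¬ ∃ g : ℂ → ℂ, DifferentiableOn ℂ g {s : ℂ | 0 < s.re} ∧
      ∀ s : ℂ, 0 < s.re → g s * riemannZeta s = NumberField.dedekindZeta K s := by
  rintro ⟨g, hg, hgeq⟩
  -- `g` vanishes on the line `Re s = 1`
  have hline : ∀ t : ℝ, g (1 + (t : ℂ) * I) = 0 := by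
    intro t
    have hz : NumberField.dedekindZeta K (1 + (t : ℂ) * I) = 0 :=
      dedekindZeta_eq_zero_of_re_le_one K (by simp)
    have hζ : riemannZeta (1 + (t : ℂ) * I) ≠ 0 := riemannZeta_ne_zero_of_one_le_re (by simp)
    have h := hgeq (1 + (t : ℂ) * I) (by simp)
    rw [hz] at h
    exact (mul_eq_zero.1 h).resolve_right hζ
  -- identity principle on the (convex, hence preconnected) open half-plane
  have hU : IsOpen {s : ℂ | 0 < s.re} := isOpen_lt continuous_const Complex.continuous_re
  have hAn : AnalyticOnNhd ℂ g {s : ℂ | 0 < s.re} := hg.analyticOnNhd hU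
  have hpre : IsPreconnected {s : ℂ | 0 < s.re} := (convex_halfSpace_re_gt 0).isPreconnected
  have hz₀ : (1 + ((1 : ℝ) : ℂ) * I : ℂ) ∈ {s : ℂ | 0 < s.re} := by simp
  -- a sequence on the line converging to `1 + i` inside the punctured neighbourhood
  have hu_tend : Tendsto (fun n : ℕ => (1 : ℝ) + 1 / ((n : ℝ) + 1)) atTop (𝓝 1) := by
    simpa using (tendsto_const_nhds (x := (1 : ℝ))).add
      (tendsto_one_div_add_atTop_nhds_zero_nat (𝕜 := ℝ))
  have hz_tend : Tendsto (fun n : ℕ => (1 + (((1 : ℝ) + 1 / ((n : ℝ) + 1) : ℝ) : ℂ) * I : ℂ)) atTop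
      (𝓝[≠] (1 + ((1 : ℝ) : ℂ) * I)) := by
    refine tendsto_nhdsWithin_iff.2 ⟨?_, Eventually.of_forall fun n => ?_⟩
    · have hc : Continuous fun t : ℝ => (1 + ((t : ℝ) : ℂ) * I : ℂ) := by fun_prop
      exact (hc.tendsto 1).comp hu_tend
    · intro hmem
      have him := congrArg Complex.im (mem_singleton_iff.1 hmem)
      simp only [Complex.add_im, Complex.one_im, Complex.mul_im, Complex.ofReal_re,
        Complex.ofReal_im, Complex.I_re, Complex.I_im, mul_zero, mul_one, zero_add, add_zero] at him
      have hpos : (0 : ℝ) < 1 / ((n : ℝ) + 1) := by positivity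
      linarith
  have hfreq : ∃ᶠ z in 𝓝[≠] (1 + ((1 : ℝ) : ℂ) * I), g z = 0 :=
    hz_tend.frequently (Frequently.of_forall fun n => hline _)
  have hEq := hAn.eqOn_zero_of_preconnected_of_frequently_eq_zero hpre hz₀ hfreq
  -- so `ζ_K(σ) = 0` for real `σ > 1`, contradicting the pole at `1`
  have hzeroK : ∀ σ : ℝ, 1 < σ → NumberField.dedekindZeta K σ = 0 := by
    intro σ hσ
    have h := hgeq σ (by simp; linarith)
    rw [hEq (show (σ : ℂ) ∈ {s : ℂ | 0 < s.re} by simp; linarith)] at h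
    simpa using h.symm
  have hlim := NumberField.tendsto_sub_one_mul_dedekindZeta_nhdsGT K
  have hlim0 : Tendsto (fun σ : ℝ ↦ ((σ : ℂ) - 1) * NumberField.dedekindZeta K σ)
      (𝓝[>] 1) (𝓝 0) := by
    refine (tendsto_const_nhds (x := (0 : ℂ))).congr' ?_
    filter_upwards [self_mem_nhdsWithin] with σ hσ
    rw [hzeroK σ hσ, mul_zero]
  have heq := tendsto_nhds_unique hlim hlim0
  exact NumberField.dedekindZeta_residue_ne_zero K (by exact_mod_cast heq)

end Summit.Langlands.Langlands.Theorems.DedekindQuotientEntire.Negative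

end
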